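import Summits.BirchSwinnertonDyer.BirchSwinnertonDyer.Theorems.SchneiderFreeAdditiveX3PoitouTateSelmerDualityHolds
import Summits.BirchSwinnertonDyer.BirchSwinnertonDyer.Theorems.SchneiderFreeAdditiveX3PoitouTateUnramifiedOrthogonalAllLevels
import Literature.NumberTheory.GaloisRepresentations.GaloisCohomologyInflationColimit
import HarnessLib

/-!
# The (R4) RECIPROCITY EQUALITY of the `Ш²`-readout road to PT2, for THE idèle projections, THE canonical invariant maps and
# the bijection `nat := −Φ⁻¹ ∘ H¹(κ)` (Milne *ADT* I Thm. 4.10 (a), proof p. 58; Tate, Cassels–Fröhlich VII §11.2 (bis))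

Cell `bsd-schneider`, seat `door-c5` g18.  Crux `stmt-BirchSwinnertonDyer-19295` `AnticycControlAdditiveK` (behind PT2 =
`Literature.NumberTheory.GaloisCohomology.poitouTate_sha_tateDual K`, bsd-wall item 20462, whose road on door-c4's canonical
presentation is `PoitouTateShaTwoReadout.shaTwo_tateDual_of_ideleProjection` — inputs `hcomp` (landed, door-c4
`selmerComplement_canonical_holds`), `hR3` (landed, door-c5 `exists_readout_eq_of_assembly`), **`nat`, `hnat`, `hR4`** (THIS FILE,
modulo ONE named input `hRur`; `nat_bijective`), and the degree-`2` package `Ψ` (bsd-wall chl-p2: (a)–(d) landed, (e) ⟸ (A) + door-c5's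
`IdeleReadout.sha_hom_units_dies_in_idele`)).  Theorems only; no definition, no named fact, no instance, no `sorry`.

THE MATHEMATICS.  `ρ₀` a finite `n`-torsion discrete `Γ_K`-module on `M`, `S = presentationComplex ρ₀ : 0 → N₁ → P → M → 0`
door-c4's canonical presentation, `(ι, κ)` a biduality pair `M ⇄ M^{DD}` (`exists_bidual_intertwining`), `Φ : Ext¹_{C_Γ}(ℤ, M) ⥲ H¹(K, M)`
door-c5's inflation bijection (`OpenLayer.extOneEquiv`, `GaloisCohomologyInflationColimit`: `Φ (Inf_U [γ]) = [σ ↦ γ(σ̄)]`).  Put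

  **`nat := −(Φ⁻¹ ∘ H¹(κ)) : H¹(K, M^{DD}) →+ Ext¹_{C_Γ}(ℤ, M)`**  (bijective: `nat_bijective`).

For `f : N₁ → J̄` and `y ∈ H¹(K, M^{DD})` write `x := H¹(κ) y ∈ H¹(K, M)`, choose a layer `E ⊇ K(M)` and a layer `1`-cocycle `γ`
with `Inf_E [γ] = Φ⁻¹ x` (`exists_layer_ge_inflG_eq`); then door-c4's inflated class `[σ ↦ γ(σ̄)]` IS `x`
(`inflatedClass_eq_extOneToGaloisCohomology_inflG`, the dictionary the abstract comparison `extTrivAddEquivGaloisCohomology` could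
not supply), so door-c4's E-side idèle package applies to `(f, Φ⁻¹ x)`: an idèle `2`-cocycle `b` of `Gal(E/K)` with
(P1) `classBarInv (Φ⁻¹ x ∘ ∂(f ≫ g)) = inv_E [b]` (`exists_cocycle_classBarInv_eq_inv`), (P3) `inv_v [b] = inv_v((π_v f)_* res_v δ₁ x)`
at every finite `v` (`localInv_H2π_eq_brauerInvariantEquiv`), (P4) the archimedean transport at every real `w`
(`twoCocycleClass_archReadoutPair_pull_eq`).  By the local formula `(1/n)⟨R_v f, loc_v y⟩_v = −inv_v((π_v f)_* res_v δ₁ x)`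
(`zmodToQmodZ_localTatePairingZMod_localReadout` with `H¹(κ_v) loc_v y = res_v x`, `res_v δ₁ = δ₁ res_v`) and its archimedean
form (`localInvInf_H2π_eq_neg_zmodToQmodZ_localTatePairingZMod_localReadout`, `H¹(ι) x = y`), EVERY local invariant of `[b]` is
minus the corresponding local pairing term:  `inv_v [b] = −(1/n)⟨R_v f, loc_v y⟩_v`.  Hence, for every finite `T' ⊇ Tf ⊇ {v ∣ ∞}` off
which `y` is unramified — where `Tf` is a finite set off which `v ∤ n`, `M^D` is unramified and the readout `R_v f` is unramified
(the named input **`hRur`**: the local readout of an idèle-valued map is unramified almost everywhere, Milne I Lemma 4.13) — the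
local invariants of `[b]` vanish off `T'` (unramified classes are orthogonal, `unramifiedSubgroup_tateDual_le_dualLocalCondition'`),
`inv_E [b] = Σ_{v ∈ T'} inv_v [b]` (`IdeleCohomology.inv_eq_sum_place`), and

  **`(1/n) Σ_{v ∈ T'} ⟨R_v f, loc_v y⟩_v = −inv_E [b] = −classBarInv (Φ⁻¹ x ∘ ∂(f ≫ g)) = classBarInv (nat y ∘ ∂(f ≫ g))`**

— VERBATIM the hypothesis `hR4` of `shaTwo_tateDual_of_ideleProjection` for `π := IdeleReadout.ideleProjection K`,
`inv := classBarInv K`, `nat := −(Φ⁻¹ ∘ H¹(κ))` (`hR4_ideleProjection_of_readoutUnramified`), for EVERY number field `K`.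

HONEST FRAMING: bookkeeping over the cited tree theorems; the one remaining input `hRur` is named, not proved, here; no case of
Poitou–Tate (a) or of BSD is proved in this file.

## References
* J. S. Milne, *Arithmetic Duality Theorems* (2nd ed. 2006), I Thm. 4.10 (a) and its proof (p. 58), Lemma 4.13, Prop. 0.19. [MilneADT2006]
* J. W. S. Cassels, A. Fröhlich (eds.), *Algebraic Number Theory* (1967), Ch. VII (Tate) §11.2 (bis), §7.3. [CasselsFrohlichANT1967]
* J.-P. Serre, *Galois Cohomology* (1997), I §2.2 Prop. 8. [SerreGaloisCohomology1997]
-/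

noncomputable section

open Function NumberField IsDedekindDomain CategoryTheory CategoryTheory.Abelian groupCohomology
open scoped NumberField ContRepresentation

set_option linter.dupNamespace false
set_option autoImplicit false

namespace Summit.BirchSwinnertonDyer.BirchSwinnertonDyer.Theorems.SchneiderFreeAdditiveX3.PoitouTateReduction

open Field
open Literature.NumberTheory.GaloisRepresentations Literature.NumberTheory.GaloisCohomology
open Literature.NumberTheory.GaloisRepresentations.DiscreteGaloisModule (mu TateDual tateDual localTatePairingZMod
  localTatePairingZMod_apply unramifiedSubgroup)
open Literature.Algebra.Homology Literature.Algebra.Homology.DiscreteRep Literature.Algebra.Homology.ExtPresentation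
open Literature.NumberTheory.GaloisRepresentations.IdeleClassBar (classBarD classBarInv GalLayer)
open Literature.NumberTheory.GaloisRepresentations.FreePresentation
open Literature.NumberTheory.GaloisRepresentations.HomDual (IdeleProjection readout readoutInvariant localReadout
  readout_eq_localReadout charZero_of_algebra equivariantMap restrictIntertwining isSES_restrict)
open Literature.NumberTheory.GaloisRepresentations.DGMBridge (LCarrier)
open Literature.NumberTheory.GaloisRepresentations.IdeleReadout (ideleProjection layerEmb)
open Literature.NumberTheory.GaloisRepresentations.OpenLayer (extOneToGaloisCohomology extOneEquiv
  extOneToGaloisCohomology_inflG_H1π_eq_of_apply extOneToGaloisCohomology_bijective extOneToGaloisCohomology_symm_apply)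
open Literature.NumberTheory.Automorphic (IdeleClassGroup.ideleRep)
open Literature.AnabelianGeometry.AbsoluteAnabelian.Prop121vii (zmodToQmodZ brauerInvariantEquiv)
open Summit.BirchSwinnertonDyer.Rank1Residual.GaloisImage.UnramifiedCup (unramifiedSubgroup_tateDual_le_dualLocalCondition')

attribute [local instance] absoluteGaloisGroup_compactSpace

variable {K : Type} [Field K] [NumberField K]

/-! ## §1 The dictionary: door-c4's inflated class IS `Φ` of the inflated layer class -/

/-- **`inflatedClass ρ₀ h γ = Φ (Inf_E [γ])`**: door-c4's explicit inflated class `[σ ↦ γ(σ̄)] ∈ H¹(K, M)` of a layer `1`-cocycle `γ`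
of `M^{U_E}` is the value of door-c5's inflation bijection `Φ` on the layer class `Inf_E [γ] ∈ Ext¹_{C_Γ}(ℤ, M)` (both are the class
of the cocycle `σ ↦ γ(σ̄)`: `pushCocycle_liftCont_apply`, `extOneToGaloisCohomology_inflG_H1π_eq_of_apply`).
[cite: SerreGaloisCohomology1997, I §2.2 Proposition 8][cite: MilneADT2006, I Thm. 4.10 (proof, p. 58)] -/
theorem inflatedClass_eq_extOneToGaloisCohomology_inflG
    {M : Type} [AddCommGroup M] [TopologicalSpace M] [DiscreteTopology M] [Finite M] (ρ₀ : DiscreteGaloisModule K M)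
    {E : GalLayer K} (h : presentationLayer ρ₀ ≤ E)
    (γ : cocycles₁ ((invariantsQuotFunctor ℤ (E.openNormalSubgroup : Subgroup (absoluteGaloisGroup K))).obj
      (presentationComplex ρ₀).X₃)) :
    inflatedClass ρ₀ h γ =
      extOneToGaloisCohomology ρ₀ (LayerColimit.inflG E.openNormalSubgroup (presentationComplex ρ₀).X₃ 1 ((H1π _) γ)) :=
  (extOneToGaloisCohomology_inflG_H1π_eq_of_apply ρ₀ E.openNormalSubgroup γ
    (IsSES.pushCocycle (liftCont ρ₀ h γ) (liftCont_crossed ρ₀ h γ)) (pushCocycle_liftCont_apply ρ₀ h γ)).symm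

/-! ## §2 `nat := −(Φ⁻¹ ∘ H¹(κ))` is bijective -/

omit [NumberField K] in
/-- `H¹(ι) (H¹(κ) y) = y` for a biduality pair with `ι ∘ κ = id`. [cite: MilneADT2006, I Prop. 0.19] -/
theorem map_map_eq_of_comp_eq {M M' : Type} [AddCommGroup M] [TopologicalSpace M] [DiscreteTopology M]
    [AddCommGroup M'] [TopologicalSpace M'] [DiscreteTopology M']
    {ρ : DiscreteGaloisModule K M} {ρ' : DiscreteGaloisModule K M'}
    (ι : ρ.toContRepresentation →ⁱL ρ'.toContRepresentation) (κ : ρ'.toContRepresentation →ⁱL ρ.toContRepresentation)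
    (hικ : ∀ m' : M', ι (κ m') = m') (y : galoisCohomology ρ' 1) :
    galoisCohomology.map ι 1 (galoisCohomology.map κ 1 y) = y := by
  obtain ⟨φ, rfl⟩ := oneCocycleClass_surjective _ y
  rw [galoisCohomology.map_one_oneCocycleClass, galoisCohomology.map_one_oneCocycleClass]
  exact congrArg (oneCocycleClass _) (Subtype.ext (ContinuousMap.ext fun σ => hικ (φ.1 σ)))

omit [NumberField K] in
/-- `H¹(κ)` is bijective for a biduality pair `(ι, κ)`. [cite: MilneADT2006, I Prop. 0.19] -/
theorem map_bijective_of_bidual {M M' : Type} [AddCommGroup M] [TopologicalSpace M] [DiscreteTopology M]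
    [AddCommGroup M'] [TopologicalSpace M'] [DiscreteTopology M']
    {ρ : DiscreteGaloisModule K M} {ρ' : DiscreteGaloisModule K M'}
    (ι : ρ.toContRepresentation →ⁱL ρ'.toContRepresentation) (κ : ρ'.toContRepresentation →ⁱL ρ.toContRepresentation)
    (hκι : ∀ m : M, κ (ι m) = m) (hικ : ∀ m' : M', ι (κ m') = m') :
    Bijective (galoisCohomology.map κ 1) := by
  refine Function.bijective_iff_has_inverse.2 ⟨galoisCohomology.map ι 1, fun y => ?_, fun x => ?_⟩
  · exact map_map_eq_of_comp_eq ι κ hικ y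
  · exact map_map_eq_of_comp_eq κ ι hκι x

omit [NumberField K] in
/-- `y ↦ −Φ⁻¹(H¹(κ) y)` is bijective (as a bare function). [cite: MilneADT2006, I Thm. 4.10 (proof, p. 58), Prop. 0.19]
[cite: SerreGaloisCohomology1997, I §2.2 Proposition 8] -/
theorem neg_extOneEquiv_symm_map_bijective {n : ℕ} [NeZero n]
    {M : Type} [AddCommGroup M] [TopologicalSpace M] [DiscreteTopology M] [Finite M] [Finite (TateDual K M n)]
    (ρ₀ : DiscreteGaloisModule K M)
    (ι : ρ₀.toContRepresentation →ⁱL ((ρ₀.tateDual n).tateDual n).toContRepresentation)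
    (κ : ((ρ₀.tateDual n).tateDual n).toContRepresentation →ⁱL ρ₀.toContRepresentation)
    (hκι : ∀ m : M, κ (ι m) = m) (hικ : ∀ φ : TateDual K (TateDual K M n) n, ι (κ φ) = φ) :
    Bijective (fun y : galoisCohomology ((ρ₀.tateDual n).tateDual n) 1 =>
      -((extOneEquiv ρ₀).symm (galoisCohomology.map κ 1 y))) :=
  neg_bijective.comp ((extOneEquiv ρ₀).symm.bijective.comp (map_bijective_of_bidual ι κ hκι hικ))

/-- **`nat := −(Φ⁻¹ ∘ H¹(κ)) : H¹(K, M^{DD}) →+ Ext¹_{C_Γ}(ℤ, M)` is bijective** — the hypothesis `hnat` of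
`shaTwo_tateDual_of_ideleProjection` for the additive map `nat` of `hR4_ideleProjection_of_readoutUnramified` (written with an
`AddMonoidHom.id` on `Ext¹(ℤ, (presentationComplex ρ₀).X₃)` so that its target is literally the road's).
[cite: MilneADT2006, I Thm. 4.10 (proof, p. 58), Prop. 0.19][cite: SerreGaloisCohomology1997, I §2.2 Proposition 8] -/
theorem nat_bijective {n : ℕ} [NeZero n]
    {M : Type} [AddCommGroup M] [TopologicalSpace M] [DiscreteTopology M] [Finite M] [Finite (TateDual K M n)]
    (ρ₀ : DiscreteGaloisModule K M)
    (ι : ρ₀.toContRepresentation →ⁱL ((ρ₀.tateDual n).tateDual n).toContRepresentation)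
    (κ : ((ρ₀.tateDual n).tateDual n).toContRepresentation →ⁱL ρ₀.toContRepresentation)
    (hκι : ∀ m : M, κ (ι m) = m) (hικ : ∀ φ : TateDual K (TateDual K M n) n, ι (κ φ) = φ) :
    Bijective (-((AddMonoidHom.id (Abelian.Ext (triv (Γ := absoluteGaloisGroup K) ℤ) (presentationComplex ρ₀).X₃ 1)).comp
      (((extOneEquiv ρ₀).symm.toAddMonoidHom).comp (galoisCohomology.map κ 1)))) :=
  neg_extOneEquiv_symm_map_bijective ρ₀ ι κ hκι hικ

/-! ## §3 The (R4) reciprocity EQUALITY for the idèle projections, modulo `hRur` -/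

set_option maxHeartbeats 1600000 in
/-- **The (R4) reciprocity equality** — VERBATIM the hypothesis `hR4` of `PoitouTateShaTwoReadout.shaTwo_tateDual_of_ideleProjection`
for `π := IdeleReadout.ideleProjection K`, `inv := classBarInv K` and `nat := −(Φ⁻¹ ∘ H¹(κ))` — for every number field `K`, every
level `n ≥ 1`, every finite `n`-torsion `ρ₀` and every biduality pair `(ι, κ)`, GIVEN `hRur`: the readout `R_v f` of each
`f : N₁ → J̄` is unramified at every finite place off a finite set `Tf` off which moreover `v ∤ n` and `M^D` is unramified.
See the module docstring for the chain of tree theorems. [cite: MilneADT2006, I Thm. 4.10 (a) (proof, p. 58), Lemma 4.13, Prop. 0.19]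
[cite: CasselsFrohlichANT1967, Ch. VII §11.2 (bis), §7.3 Cor. 7.4 (b)] -/
theorem hR4_ideleProjection_of_readoutUnramified {n : ℕ} [NeZero n]
    {M : Type} [AddCommGroup M] [TopologicalSpace M] [DiscreteTopology M] [Finite M] [Finite (TateDual K M n)]
    (ρ₀ : DiscreteGaloisModule K M) (hM : ∀ m : M, n • m = 0)
    (ι : ρ₀.toContRepresentation →ⁱL ((ρ₀.tateDual n).tateDual n).toContRepresentation)
    (κ : ((ρ₀.tateDual n).tateDual n).toContRepresentation →ⁱL ρ₀.toContRepresentation)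
    (hι : ∀ (m : M) (g : TateDual K M n), ι m g = g m) (hκι : ∀ m : M, κ (ι m) = m)
    (hικ : ∀ φ : TateDual K (TateDual K M n) n, ι (κ φ) = φ)
    (hRur : ∀ f : (presentationComplex ρ₀).X₁ ⟶ (ideleClassLimitShortComplex K).X₂, ∃ Tf : Finset (Place K),
      ∀ v : HeightOneSpectrum (𝓞 K), (Sum.inr v : Place K) ∉ Tf →
        ((n : ℕ) : 𝓞 K) ∉ v.asIdeal ∧ GaloisRep.IsUnramifiedAt v (ρ₀.tateDual n) ∧
          readout ρ₀ n hM (ideleProjection K (Sum.inr v)) f ∈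
            unramifiedSubgroup (GaloisRep.toLocal v (ρ₀.tateDual n)) 1) :
    ∀ f : (presentationComplex ρ₀).X₁ ⟶ (ideleClassLimitShortComplex K).X₂, ∃ Tf : Finset (Place K),
      ∀ (y : galoisCohomology ((ρ₀.tateDual n).tateDual n) 1) (T' : Finset (Place K)), Tf ⊆ T' →
        (∀ v : HeightOneSpectrum (𝓞 K), (Sum.inr v : Place K) ∉ T' →
          galoisCohomology.localization ((ρ₀.tateDual n).tateDual n) (Sum.inr v) 1 y ∈
            unramifiedSubgroup (GaloisRep.toLocal v ((ρ₀.tateDual n).tateDual n)) 1) →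
        zmodToQmodZ n (∑ v ∈ T', localTatePairingZMod (ρ₀.tateDual n) n v (LocalInvariants.canonical K n v)
          (readout ρ₀ n hM (ideleProjection K v) f)
          (galoisCohomology.localization ((ρ₀.tateDual n).tateDual n) v 1 y)) =
        classBarInv K (((-((AddMonoidHom.id (Abelian.Ext (triv (Γ := absoluteGaloisGroup K) ℤ) (presentationComplex ρ₀).X₃ 1)).comp
            (((extOneEquiv ρ₀).symm.toAddMonoidHom).comp (galoisCohomology.map κ 1)))) y).comp
          (boundary (presentationComplex_shortExact ρ₀) (classBarD K)
            (f ≫ (ideleClassLimitShortComplex K).g)) (rfl : 1 + 1 = 2)) := by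
  haveI : TotallyDisconnectedSpace (absoluteGaloisGroup K) := inferInstance
  intro f
  classical
  obtain ⟨Tf₀, hTf₀⟩ := hRur f
  -- `Tf`: the exceptional set of `hRur` together with all infinite places
  refine ⟨Tf₀ ∪ Finset.univ.image Sum.inl, fun y T' hT' hy => ?_⟩
  have hinf : ∀ w : InfinitePlace K, (Sum.inl w : Place K) ∈ T' := fun w =>
    hT' (Finset.mem_union_right _ (Finset.mem_image_of_mem _ (Finset.mem_univ w)))
  have hTf₀T' : ∀ v : HeightOneSpectrum (𝓞 K), (Sum.inr v : Place K) ∉ T' → (Sum.inr v : Place K) ∉ Tf₀ :=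
    fun v hv h => hv (hT' (Finset.mem_union_left _ h))
  haveI := moduleFinite_presModule₁ ρ₀
  haveI := moduleFinite_presModule₂ ρ₀
  have hκ : ∀ (Φ : TateDual K (TateDual K M n) n) (g : TateDual K M n), Φ g = g (κ Φ) := fun Φ g => by
    conv_lhs => rw [← hικ Φ]
    exact hι (κ Φ) g
  -- the global class `x := H¹(κ) y` and its `Ext`-avatar `ŷ := Φ⁻¹ x`
  set x : galoisCohomology ρ₀ 1 := galoisCohomology.map κ 1 y with hx
  have hιx : galoisCohomology.map ι 1 x = y := map_map_eq_of_comp_eq ι κ hικ y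
  set ŷ : Abelian.Ext (triv (Γ := absoluteGaloisGroup K) ℤ) (presentationComplex ρ₀).X₃ 1 := (extOneEquiv ρ₀).symm x with hŷ
  have hΦŷ : extOneToGaloisCohomology ρ₀ ŷ = x := extOneToGaloisCohomology_symm_apply ρ₀ x
  -- a layer `E ⊇ K(M)` and a layer cocycle `γ` with `Inf_E [γ] = ŷ`
  obtain ⟨E, hE, c, hc⟩ := exists_layer_ge_inflG_eq (presentationLayer ρ₀) (presentationComplex ρ₀).X₃ 1 ŷ
  have hsurj : ∀ c' : groupCohomology ((invariantsQuotFunctor ℤ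
      (E.openNormalSubgroup : Subgroup (absoluteGaloisGroup K))).obj (presentationComplex ρ₀).X₃) 1,
      ∃ γ : cocycles₁ ((invariantsQuotFunctor ℤ (E.openNormalSubgroup : Subgroup (absoluteGaloisGroup K))).obj
        (presentationComplex ρ₀).X₃), (H1π _) γ = c' := fun c' =>
    H1_induction_on (C := fun c' => ∃ γ : cocycles₁ ((invariantsQuotFunctor ℤ
      (E.openNormalSubgroup : Subgroup (absoluteGaloisGroup K))).obj (presentationComplex ρ₀).X₃), (H1π _) γ = c') c'
      fun γ => ⟨γ, rfl⟩
  obtain ⟨γ, rfl⟩ := hsurj c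
  -- the inflated class of `γ` IS `x`
  have hxγ : inflatedClass ρ₀ hE γ = x := by
    rw [inflatedClass_eq_extOneToGaloisCohomology_inflG, hc, hΦŷ]
  -- door-c4's idèle cocycle `b` with (P1)
  obtain ⟨b, T, hb, hP1, -⟩ := exists_cocycle_classBarInv_eq_inv ρ₀ hE ((H1π _) γ) f
  haveI := E.numberField
  haveI := E.isGalois
  haveI := E.finiteDimensional
  -- every finite local invariant of `[b]` is minus the local pairing term
  have hfin : ∀ v : HeightOneSpectrum (𝓞 K),
      IdeleCohomology.localInv E.1 v ((H2π (IdeleClassGroup.ideleRep K E.1)) b) =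
        - zmodToQmodZ n (localTatePairingZMod (ρ₀.tateDual n) n (Sum.inr v) (LocalInvariants.canonical K n (Sum.inr v))
          (readout ρ₀ n hM (ideleProjection K (Sum.inr v)) f)
          (galoisCohomology.localization ((ρ₀.tateDual n).tateDual n) (Sum.inr v) 1 y)) := by
    intro v
    haveI : CharZero (v.adicCompletion K) := charZero_of_algebra (K := K) (v.adicCompletion K)
    have key := HomDual.zmodToQmodZ_localTatePairingZMod_localReadout_global ρ₀ n hM v ι κ hκι hκ
      (readoutInvariant (ideleProjection K (Sum.inr v)) (presentationComplex ρ₀).X₁ f) x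
    rw [hιx] at key
    have hP3 := localInv_H2π_eq_brauerInvariantEquiv ρ₀ hE v γ f b hb
    rw [hxγ] at hP3
    rw [hP3]
    exact (neg_eq_iff_eq_neg.mp key.symm)
  -- every archimedean local invariant of `[b]` is minus the local pairing term
  have hinfv : ∀ w : InfinitePlace K,
      IdeleCohomology.localInvInf E.1 w ((H2π (IdeleClassGroup.ideleRep K E.1)) b) =
        - zmodToQmodZ n (localTatePairingZMod (ρ₀.tateDual n) n (Sum.inl w) (LocalInvariants.canonical K n (Sum.inl w))
          (readout ρ₀ n hM (ideleProjection K (Sum.inl w)) f)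
          (galoisCohomology.localization ((ρ₀.tateDual n).tateDual n) (Sum.inl w) 1 y)) := by
    intro w
    have hP4 : w.IsReal →
        (twoCocycleClass (DiscreteGaloisModule.units w.Completion).toTopRep
            ((IdeleCohomology.archReadoutPair w (layerEmb E)).pull b) = 0 ↔
          cohomologyMap (toTopRepHom ((presModule₁ ρ₀).restrictField w.Completion) (DiscreteGaloisModule.units w.Completion)
              (equivariantMap ((presModule₁ ρ₀).restrictField w.Completion) (DiscreteGaloisModule.units w.Completion)
                (readoutInvariant (ideleProjection K (Sum.inl w)) (presentationComplex ρ₀).X₁ f))) 2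
            (galoisCohomology.res (presModule₁ ρ₀) w.Completion 2 ((pres_isSES ρ₀).δ₁ x)) = 0) := fun _ => by
      rw [← hxγ]
      exact iff_of_eq (congrArg (fun t => t = 0) (twoCocycleClass_archReadoutPair_pull_eq ρ₀ hE w γ f b hb))
    have key := HomDual.localInvInf_H2π_eq_neg_zmodToQmodZ_localTatePairingZMod_localReadout ρ₀ n hM w (layerEmb E) b
      ι κ hκι hκ (readoutInvariant (ideleProjection K (Sum.inl w)) (presentationComplex ρ₀).X₁ f) x hP4
    rw [hιx] at key
    exact key
  -- off `T'` the local pairing terms vanish (unramified classes are orthogonal), hence so do the local invariants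
  have hzero : ∀ v : HeightOneSpectrum (𝓞 K), (Sum.inr v : Place K) ∉ T' →
      localTatePairingZMod (ρ₀.tateDual n) n (Sum.inr v) (LocalInvariants.canonical K n (Sum.inr v))
          (readout ρ₀ n hM (ideleProjection K (Sum.inr v)) f)
          (galoisCohomology.localization ((ρ₀.tateDual n).tateDual n) (Sum.inr v) 1 y) = 0 := by
    intro v hv
    obtain ⟨hvn, hur, hRv⟩ := hTf₀ v (hTf₀T' v hv)
    have hle := unramifiedSubgroup_tateDual_le_dualLocalCondition' (ρ₀.tateDual n) n v
      (LocalInvariants.canonical K n) hvn hur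
    exact (LocalInvariants.mem_dualLocalCondition_iff (LocalInvariants.canonical K n) (ρ₀.tateDual n) (Sum.inr v) _ _).1
      (hle (hy v hv)) _ hRv
  have hT : ∀ v : HeightOneSpectrum (𝓞 K), (Sum.inr v : Place K) ∉ T' →
      IdeleCohomology.localInv E.1 v ((H2π (IdeleClassGroup.ideleRep K E.1)) b) = 0 := fun v hv => by
    rw [hfin v, hzero v hv, map_zero, neg_zero]
  -- the right-hand side: `classBarInv (nat y ∘ ∂) = − inv_E [b] = − Σ_{T'} (local invariants)`
  have hnat : (-((AddMonoidHom.id (Abelian.Ext (triv (Γ := absoluteGaloisGroup K) ℤ) (presentationComplex ρ₀).X₃ 1)).comp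
      (((extOneEquiv ρ₀).symm.toAddMonoidHom).comp (galoisCohomology.map κ 1)))) y =
      -(LayerColimit.inflG E.openNormalSubgroup (presentationComplex ρ₀).X₃ 1 ((H1π _) γ)) := by
    rw [hc]
    rfl
  have hneg : ∀ a : Abelian.Ext (triv (Γ := absoluteGaloisGroup K) ℤ) (presentationComplex ρ₀).X₃ 1,
      classBarInv K ((-a).comp (boundary (presentationComplex_shortExact ρ₀) (classBarD K)
        (f ≫ (ideleClassLimitShortComplex K).g)) (rfl : 1 + 1 = 2)) =
      - classBarInv K (a.comp (boundary (presentationComplex_shortExact ρ₀) (classBarD K)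
        (f ≫ (ideleClassLimitShortComplex K).g)) (rfl : 1 + 1 = 2)) := fun a => by
    rw [← map_neg]
    exact congrArg (classBarInv K) (Ext.neg_comp a _ _)
  rw [hnat, hneg, hP1,
    IdeleCohomology.inv_eq_sum_place (E := E.1) ((H2π (IdeleClassGroup.ideleRep K E.1)) b) T' hinf hT,
    ← Finset.sum_neg_distrib, map_sum]
  refine Finset.sum_congr rfl ?_
  rintro (w | v) -
  · change _ = - IdeleCohomology.localInvInf E.1 w ((H2π (IdeleClassGroup.ideleRep K E.1)) b)
    rw [hinfv w, neg_neg]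
  · change _ = - IdeleCohomology.localInv E.1 v ((H2π (IdeleClassGroup.ideleRep K E.1)) b)
    rw [hfin v, neg_neg]

end Summit.BirchSwinnertonDyer.BirchSwinnertonDyer.Theorems.SchneiderFreeAdditiveX3.PoitouTateReduction

end
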